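import Summits.PneNP.PneNP.Theses.NegLimited
import Literature.Computability.Complexity.UpperTriangleBricks
import Literature.Barriers.PneNP.TardosFunctionFP
import Literature.Barriers.PneNP.MonotoneGapProofs
import Literature.Barriers.PneNP.NegationLimitedGapSingleOutputSqrtLog
import Literature.Computability.Complexity.ThetaApproximationProofs
import Literature.Computability.Complexity.NondeterministicProofs
import Literature.Computability.Complexity.ReductionsProofs
import Literature.Computability.Complexity.CircuitInputMap
import Literature.Computability.Complexity.NegationLimited

/-!
# Route NegLimited — `NeglimitedAllCLoglogNegations` (stmt-PneNP-0412) and its companions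

PROVES, with no hypothesis, the crux `Summit.PneNP.PneNP.Theses.NegLimited.NeglimitedAllCLoglogNegations`
(stmt-PneNP-0412: for every `c` an NP language whose slices infinitely often need De Morgan circuits of
size `> n^k` under the NOT budget `c · log₂ log₂ n`, measured by `negLimitedSizeOver`, junk `0` ⇒ the
admissible class must be nonempty), the refuter-prescribed monotone repair R3R (same with
`Monotone (L.sliceFn n)`), and — as an implication from T1 = `CliqueLikeNegLimitedLog` (the
`Θ(log m / log log m)` negation-limited bound for every `(⌊√m⌋-1, ⌊√m⌋)`-clique function, proved in the
cell file `PortNegLimLog.lean`, to land as `Theorems/CliqueLikeNegLimitedLog.lean`) — the rung statement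
R35 (`NeglimitedLogOverLoglogNegations`, budget `log₂ n / (40 (log₂ log₂ n + 1))`).

The witness is ONE explicit language `L ∈ P ⊆ NP`: `L = cleanFn ⁻¹' tardosLang F`, where `F ∈ FP` is
the tree's PROVED Grötschel–Lovász–Schrijver routine (`GLS1981_thetaApprox_unary_FP_holds`),
`tardosLang F ∈ P` is Tardos's program (`tardosLang_mem_P`), and `UpperTriangle.cleanFn ∈ FP` (brick algebra,
`Literature/Computability/Complexity/UpperTriangleBricks.lean`) maps an `m × m` bit matrix to the complement code (`complCode`) of the graph read off its upper
triangle. So the slice `L_{m²}` is `x ↦ T_m (x ∘ edgePos)` with `T_m = tardosFn (approxOf F m) ⌊√m⌋`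
Tardos's clique-like function (`cliqueLike_tardosFn`). Lower bounds transfer along the input
retraction `edgeOfPos` (`Circuit.mapInputs`: same size, basis and number of NOT gates —
`negationCount_mapInputs`), nonemptiness of the admissible class comes from
`exists_monotone_circuit_of_cliqueLike` renamed along `edgePos`, and the lower bound is the tree's
`Literature.Barriers.PneNP.cliqueLike_sqrt_negationLimited_sqrtLog` (budget
`sqrtLogBudget m = Θ(√(log m)/log log m)` ⊇ every `c log₂ log₂ (m²)` eventually), resp. T1 for R35.
Infinitely often = at the square lengths `n = m²`.

References: Amano–Maruoka 2005 §1 [AmanoMaruoka2005]; Jukna 2012 §10.5 (PDF p. 310), Thm. 9.26,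
Lemma 9.27/Thm. 9.28 [Jukna2012]; Tardos 1988 [Tardos1988]; Arora–Barak 2009 Thm. 2.8, Claim 2.4
[AroraBarakCC2009].
-/

set_option linter.dupNamespace false

namespace Summit.PneNP.PneNP.Theorems.NegLimSlices

open Literature.Computability.Complexity Literature.Computability.Complexity.Brick
  Literature.Barriers.PneNP _root_.Computability Polynomial Filter Finset

/-! ## Part A — circuits: renaming inputs, lower-bound transfer, edge vectors -/

/-- Renaming inputs keeps every weighted gate count. [folklore] -/
theorem sizeWith_mapInputs {ι κ : Type*} (e : ι → κ) (C : Circuit ι) (w : GateFn → ℕ) :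
    (C.mapInputs e).sizeWith w = C.sizeWith w := by
  simp [Circuit.mapInputs, GateList.toCircuit, Circuit.sizeWith, List.map_map, Function.comp_def,
    GateList.reloc_fn]

/-- **Renaming inputs keeps the number of NOT gates.** [folklore] -/
theorem negationCount_mapInputs {ι κ : Type*} (e : ι → κ) (C : Circuit ι) :
    (C.mapInputs e).negationCount = C.negationCount := by
  rw [Circuit.negationCount_eq, Circuit.negationCount_eq, sizeWith_mapInputs]

/-- **Transfer of negation-limited lower bounds along an input map.** If `f (y ∘ e) = g y` for
all `y` (every circuit for `f`, inputs renamed along `e`, computes `g`), if `f` has SOME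
admissible circuit (so that `negLimitedSizeOver` is attained, not the junk `0`), and if every
admissible circuit for `g` has at least `s` gates, then `s ≤ negLimitedSizeOver B b f`. [folklore] -/
theorem le_negLimitedSizeOver_of_retract {ι κ : Type*} {B : Set GateFn} {b s : ℕ}
    {f : (ι → Bool) → Bool} {g : (κ → Bool) → Bool} (e : ι → κ)
    (hfg : ∀ y : κ → Bool, f (fun i => y (e i)) = g y)
    (hne : ∃ C : Circuit ι, C.IsOver B ∧ C.negationCount ≤ b ∧ C.Computes f)
    (hlow : ∀ D : Circuit κ, D.IsOver B → D.Computes g → D.negationCount ≤ b → s ≤ D.size) :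
    s ≤ negLimitedSizeOver B b f := by
  obtain ⟨C₀, h₀B, h₀b, h₀f⟩ := hne
  have hmem : negLimitedSizeOver B b f ∈
      {s | ∃ C : Circuit ι, C.IsOver B ∧ C.negationCount ≤ b ∧ C.Computes f ∧ C.size = s} :=
    Nat.sInf_mem ⟨C₀.size, C₀, h₀B, h₀b, h₀f, rfl⟩
  obtain ⟨C, hB, hb, hf, hs⟩ := hmem
  rw [← hs]
  have h := hlow (C.mapInputs e) (hB.mapInputs e)
    (fun y => by rw [Circuit.eval_mapInputs, hf, hfg])
    (by rw [negationCount_mapInputs]; exact hb)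
  simpa using h

variable {m : ℕ}

/-- The matrix position of an edge `{i, j}`: `(min, max)`, row-major (`finProdFinEquiv`,
`(a, b) ↦ b + m a`). [folklore] -/
def edgePos (e : KEdge m) : Fin (m * m) :=
  Sym2.lift ⟨fun i j => finProdFinEquiv (min i j, max i j), fun i j => by
    show finProdFinEquiv (min i j, max i j) = finProdFinEquiv (min j i, max j i)
    rw [min_comm, max_comm]⟩ e.1

/-- The edge vector of an `m × m` bit matrix: its upper triangle (a pure renaming of inputs).
[folklore] -/
def edgeVec (w : Fin (m * m) → Bool) : KEdge m → Bool := fun e => w (edgePos e)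

/-- The input retraction: matrix position `(a, b)` ↦ edge `{a, b}` off the diagonal, a fixed
edge `e₀` on it. [folklore] -/
def edgeOfPos (e₀ : KEdge m) (p : Fin (m * m)) : KEdge m :=
  if h : (finProdFinEquiv.symm p).1 = (finProdFinEquiv.symm p).2 then e₀
  else ⟨s((finProdFinEquiv.symm p).1, (finProdFinEquiv.symm p).2), by simpa using h⟩

/-- `edgeOfPos ∘ edgePos = id`. [folklore] -/
theorem edgeOfPos_edgePos (e₀ e : KEdge m) : edgeOfPos e₀ (edgePos e) = e := by
  obtain ⟨e, he⟩ := e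
  induction e using Sym2.ind with
  | h i j =>
    have hij : i ≠ j := by simpa using he
    have hmm : min i j ≠ max i j := by
      rcases le_total i j with h | h
      · rw [min_eq_left h, max_eq_right h]; exact hij
      · rw [min_eq_right h, max_eq_left h]; exact hij.symm
    have hs : s(min i j, max i j) = s(i, j) := by
      rcases le_total i j with h | h
      · rw [min_eq_left h, max_eq_right h]
      · rw [min_eq_right h, max_eq_left h, Sym2.eq_swap]
    simp only [edgePos, Sym2.lift_mk]
    unfold edgeOfPos
    simp only [Equiv.symm_apply_apply, hmm, dite_false]
    exact Subtype.ext hs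

/-- Reading the edge vector back through the retraction is the identity. [folklore] -/
theorem edgeVec_comp_edgeOfPos (e₀ : KEdge m) (y : KEdge m → Bool) :
    edgeVec (fun p => y (edgeOfPos e₀ p)) = y :=
  funext fun e => by simp only [edgeVec, edgeOfPos_edgePos]

/-- The upper-triangle position stays inside the square. [folklore] -/
private theorem triPos_lt {m t : ℕ} (ht : t < m * m) :
    min (t / m) (t % m) * m + max (t / m) (t % m) < m * m := by
  have hm : 0 < m := Nat.pos_of_ne_zero (by rintro rfl; simp at ht)
  have h1 : t % m < m := Nat.mod_lt _ hm
  have h2 : t / m < m := Nat.div_lt_of_lt_mul ht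
  have h3 : min (t / m) (t % m) ≤ m - 1 := by omega
  have h4 : max (t / m) (t % m) ≤ m - 1 := by omega
  calc min (t / m) (t % m) * m + max (t / m) (t % m) ≤ (m - 1) * m + (m - 1) :=
        Nat.add_le_add (Nat.mul_le_mul_right _ h3) h4
    _ < m * m := by
      obtain ⟨k, rfl⟩ : ∃ k, m = k + 1 := ⟨m - 1, by omega⟩
      simp; nlinarith

/-- **The complement bits of the edge vector of `w` are the entries of the cleaned matrix.**
[folklore] -/
theorem complBits_edgeVec (w : Fin (m * m) → Bool) (t : Fin (m * m)) :
    complBits (edgeVec w) t = UpperTriangle.entry (List.ofFn w) m t := by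
  have hfst : ((finProdFinEquiv.symm t).1 : ℕ) = (t : ℕ) / m := by simp
  have hsnd : ((finProdFinEquiv.symm t).2 : ℕ) = (t : ℕ) % m := by simp
  unfold complBits UpperTriangle.entry
  by_cases h : (t : ℕ) / m = (t : ℕ) % m
  · have h' : (finProdFinEquiv.symm t).1 = (finProdFinEquiv.symm t).2 :=
      Fin.ext (by rw [hfst, hsnd, h])
    rw [dif_pos h', if_pos h]
  · have h' : (finProdFinEquiv.symm t).1 ≠ (finProdFinEquiv.symm t).2 := fun heq =>
      h (by rw [← hfst, ← hsnd, heq])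
    rw [dif_neg h', if_neg h, List.getD_eq_getElem _ _ (by simpa using triPos_lt t.2),
      List.getElem_ofFn]
    simp only [edgeVec, edgePos, Sym2.lift_mk]
    congr 2
    apply Fin.ext
    rw [finProdFinEquiv_apply_val, Fin.coe_max, Fin.coe_min, hfst, hsnd]
    ring

/-- **The cleaning brick computes the complement code of the edge vector.** [folklore] -/
theorem cleanFn_ofFn (w : Fin (m * m) → Bool) : UpperTriangle.cleanFn (List.ofFn w) = complCode (edgeVec w) := by
  rw [UpperTriangle.cleanFn_sq (m := m) (by simp), complCode_eq_ofFn]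
  congr 1
  funext t
  exact (complBits_edgeVec w t).symm

/-! ## Part C — the witness language and its slices -/

/-- **The witness language**: bit matrices whose cleaned complement code Tardos's program
accepts. [folklore] -/
def witnessLang (F : List Bool → List Bool) : Language Bool := UpperTriangle.cleanFn ⁻¹' tardosLang F

/-- The witness language is in `P` (`tardosLang_mem_P`, `preimage_mem_P`, `cleanFn_mem_FP`).
[cite: AroraBarakCC2009, Thm. 2.8] -/
theorem witnessLang_mem_P {F : List Bool → List Bool} (hF : F ∈ FP) :
    witnessLang F ∈ Classes.P :=
  preimage_mem_P (tardosLang_mem_P F hF) UpperTriangle.cleanFn_mem_FP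

/-- The witness language is in `NP` (`P ⊆ NP`). [cite: AroraBarak2009, Claim 2.4] -/
theorem witnessLang_mem_NP {F : List Bool → List Bool} (hF : F ∈ FP) :
    witnessLang F ∈ Nondeterministic.NP :=
  P_subset_NP_holds (witnessLang_mem_P hF)

/-- **The slice at length `m²` is Tardos's function of the edge vector.** [folklore] -/
theorem sliceFn_witnessLang {F : List Bool → List Bool} (hF : IsThetaApprox F) (hm : 1 ≤ m)
    (w : Fin (m * m) → Bool) :
    (witnessLang F).sliceFn (m * m) w = tardosFn (approxOf F m) (Nat.sqrt m) (edgeVec w) := by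
  show (witnessLang F).boolIndicator (List.ofFn w) = _
  rw [Bool.eq_iff_iff, ← Set.mem_iff_boolIndicator, witnessLang, Set.mem_preimage, cleanFn_ofFn,
    tardosLang, Set.mem_setOf_eq, tardosProg_complCode hF hm]
  simp

/-- **The transfer package at a square length.** For `m ≥ 4` and any NOT budget `b`: if every
De Morgan circuit with `≤ b` NOT gates computing a `(⌊√m⌋-1, ⌊√m⌋)`-clique function on `m`
vertices has at least `s` gates, then `s ≤ negLimitedSizeOver deMorganBasis b (L_{m²})`.
[folklore] -/
theorem le_negLimitedSizeOver_sliceFn {F : List Bool → List Bool} (hF : IsThetaApprox F)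
    (hm : 4 ≤ m) {b s : ℕ}
    (hlow : ∀ T : (KEdge m → Bool) → Bool,
      CliqueLike (univ : Finset (Fin m)) (Nat.sqrt m - 1) (Nat.sqrt m) T →
      ∀ D : Circuit (KEdge m), D.IsOver deMorganBasis → D.Computes T →
        D.negationCount ≤ b → s ≤ D.size) :
    s ≤ negLimitedSizeOver deMorganBasis b ((witnessLang F).sliceFn (m * m)) := by
  have hk : 2 ≤ Nat.sqrt m := Nat.le_sqrt'.2 (by omega)
  set T := tardosFn (approxOf F m) (Nat.sqrt m) with hT
  have hTcl : CliqueLike (univ : Finset (Fin m)) (Nat.sqrt m - 1) (Nat.sqrt m) T :=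
    cliqueLike_tardosFn (by omega) (by omega) _ fun G => approxOf_spec hF (by omega) G
  have e₀ : KEdge m := ⟨s(⟨0, by omega⟩, ⟨1, by omega⟩), by simp [Fin.ext_iff]⟩
  refine le_negLimitedSizeOver_of_retract (g := T) (edgeOfPos e₀) (fun y => ?_) ?_
    (hlow T hTcl)
  · rw [sliceFn_witnessLang hF (by omega), edgeVec_comp_edgeOfPos]
  · obtain ⟨C₀, hB₀, hC₀⟩ :=
      exists_monotone_circuit_of_cliqueLike hTcl (by omega) (Nat.sqrt_le_self m)
    refine ⟨C₀.mapInputs edgePos, (hB₀.mapInputs _).mono monotoneBasis_subset_deMorgan, ?_,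
      fun x => ?_⟩
    · rw [negationCount_mapInputs, Circuit.negationCount_eq_zero_of_isOver_monotoneBasis hB₀]
      exact Nat.zero_le _
    · rw [Circuit.eval_mapInputs, hC₀, sliceFn_witnessLang hF (by omega)]
      rfl

/-- From `∀ᶠ m, P (m²)` to `∃ᶠ n, P n`. [folklore] -/
theorem frequently_of_eventually_sq {P : ℕ → Prop} (h : ∀ᶠ m in atTop, P (m * m)) :
    ∃ᶠ n in atTop, P n := by
  rw [frequently_atTop]
  intro a
  obtain ⟨M, hM⟩ := eventually_atTop.1 h
  refine ⟨max M (max a 1) * max M (max a 1), ?_, hM _ (le_max_left _ _)⟩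
  calc a ≤ max M (max a 1) := le_trans (le_max_left a 1) (le_max_right _ _)
    _ ≤ max M (max a 1) * max M (max a 1) := Nat.le_mul_self _

/-! ## Part D — the budget bridge `c · log₂ log₂ (m²) ≤ sqrtLogBudget m` -/

/-- `log₂ (m²) ≤ 2 log₂ m + 1`. [folklore] -/
theorem log_sq_le (m : ℕ) : Nat.log 2 (m * m) ≤ 2 * Nat.log 2 m + 1 := by
  rcases Nat.lt_or_ge m 1 with hm | hm
  · interval_cases m; simp
  have h3 : m < 2 ^ (Nat.log 2 m + 1) := Nat.lt_pow_succ_log_self (by norm_num) m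
  have h2 : m * m < 2 ^ (2 * Nat.log 2 m + 2) := by
    calc m * m < 2 ^ (Nat.log 2 m + 1) * 2 ^ (Nat.log 2 m + 1) := Nat.mul_lt_mul_of_lt_of_lt h3 h3
      _ = 2 ^ (2 * Nat.log 2 m + 2) := by rw [← pow_add]; ring_nf
  have := Nat.log_lt_of_lt_pow (by positivity) h2
  omega

/-- `log₂ log₂ (m²) ≤ log₂ log₂ m + 2` (`log₂ (m²) ≤ 2 log₂ m + 1 ≤ 4 log₂ m`). [folklore] -/
theorem loglog_sq_le (m : ℕ) : Nat.log 2 (Nat.log 2 (m * m)) ≤ Nat.log 2 (Nat.log 2 m) + 2 := by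
  rcases Nat.lt_or_ge m 2 with hm | hm
  · interval_cases m <;> simp
  have hL : 1 ≤ Nat.log 2 m := Nat.log_pos (by norm_num) hm
  have h1 : Nat.log 2 (m * m) ≤ Nat.log 2 m * 2 * 2 := by have := log_sq_le m; omega
  calc Nat.log 2 (Nat.log 2 (m * m)) ≤ Nat.log 2 (Nat.log 2 m * 2 * 2) := Nat.log_mono_right h1
    _ = Nat.log 2 (Nat.log 2 m) + 2 := by
        rw [Nat.log_mul_base (by norm_num) (by positivity), Nat.log_mul_base (by norm_num) (by omega)]

/-- **The budget bridge**: `c · log₂ log₂ (m²) ≤ sqrtLogBudget m` as soon as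
`log₂ log₂ m ≥ max 64 (c + 2)` (via `(log₂ log₂ m)² ≤ sqrtLogBudget m`,
`sq_loglog_le_sqrtLogBudget`). [folklore] -/
theorem budget_le_sqrtLogBudget {c m : ℕ} (hK : 64 ≤ Nat.log 2 (Nat.log 2 m))
    (hc : c + 2 ≤ Nat.log 2 (Nat.log 2 m)) :
    c * Nat.log 2 (Nat.log 2 (m * m)) ≤ sqrtLogBudget m := by
  refine le_trans ?_ (sq_loglog_le_sqrtLogBudget hK)
  set K := Nat.log 2 (Nat.log 2 m)
  calc c * Nat.log 2 (Nat.log 2 (m * m)) ≤ c * (K + 2) := Nat.mul_le_mul_left c (loglog_sq_le m)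
    _ ≤ K ^ 2 := by nlinarith

/-- `log₂ m → ∞`. [folklore] -/
theorem tendsto_log2_atTop : Tendsto (Nat.log 2) atTop atTop :=
  tendsto_atTop_atTop.2 fun K => ⟨2 ^ K, fun _ hm => Nat.le_log_of_pow_le one_lt_two hm⟩

/-- `log₂ log₂ m → ∞`. [folklore] -/
theorem tendsto_loglog : Tendsto (fun m => Nat.log 2 (Nat.log 2 m)) atTop atTop :=
  tendsto_log2_atTop.comp tendsto_log2_atTop

/-! ## Part E — the three ledger statements -/

/-- **stmt-PneNP-0412 (`NegLimited.NeglimitedAllCLoglogNegations`), verbatim.** One explicit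
`L ∈ P ⊆ NP` (the same for every `c`) whose slices at square lengths `n = m²` need De Morgan
circuits of size `> n^k` under every NOT budget `c · log₂ log₂ n` — indeed under
`sqrtLogBudget m = Θ(√(log n)/log log n)`. [cite: AmanoMaruoka2005, §1] [cite: Jukna2012, §10.5 (PDF p. 310)] -/
theorem neglimitedAllCLoglogNegations :
    ∀ c : ℕ, ∃ L ∈ Literature.Computability.Complexity.Nondeterministic.NP, ∀ k : ℕ,
      ∃ᶠ n : ℕ in Filter.atTop, n ^ k <
        Literature.Computability.Complexity.negLimitedSizeOver
          Literature.Computability.Complexity.deMorganBasis (c * Nat.log 2 (Nat.log 2 n))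
          (L.sliceFn n) := by
  obtain ⟨F, hF, hspec⟩ := GLS1981_thetaApprox_unary_FP_holds
  have hspec' : IsThetaApprox F := hspec
  intro c
  refine ⟨witnessLang F, witnessLang_mem_NP hF, fun k => frequently_of_eventually_sq ?_⟩
  filter_upwards [cliqueLike_sqrt_negationLimited_sqrtLog (2 * k + 1), eventually_ge_atTop 4,
    tendsto_loglog.eventually_ge_atTop (max 64 (c + 2))] with m hm h4 hK
  have hb := budget_le_sqrtLogBudget (le_trans (le_max_left _ _) hK) (le_trans (le_max_right _ _) hK)
  have hle : m ^ (2 * k + 1) ≤ negLimitedSizeOver deMorganBasis (c * Nat.log 2 (Nat.log 2 (m * m)))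
      ((witnessLang F).sliceFn (m * m)) :=
    le_negLimitedSizeOver_sliceFn hspec' h4 fun T hT D hD hDT hneg =>
      hm T hT D hD hDT (hneg.trans hb)
  calc (m * m) ^ k = m ^ (2 * k) := by rw [← pow_two, ← pow_mul]
    _ < m ^ (2 * k + 1) := Nat.pow_lt_pow_right (by omega) (by omega)
    _ ≤ _ := hle

end Summit.PneNP.PneNP.Theorems.NegLimSlices

namespace Summit.PneNP.PneNP.Theorems

/-- **stmt-PneNP-0412 (`NegLimited.NeglimitedAllCLoglogNegations`) PROVED, by name.**
[cite: AmanoMaruoka2005, §1] [cite: Jukna2012, §10.5 (PDF p. 310)] -/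
theorem neglimitedAllCLoglogNegations_holds :
    Summit.PneNP.PneNP.Theses.NegLimited.NeglimitedAllCLoglogNegations :=
  NegLimSlices.neglimitedAllCLoglogNegations

end Summit.PneNP.PneNP.Theorems
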